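import Summits.QuantumFields.QCD.Theorems.WilsonMobilityGapChiralGluonicCompletionOffsetCertificate
import Summits.QuantumFields.QCD.Theorems.WilsonMobilityGapChiralGluonicCompletionStubTwistedClusterBound
import Literature.MathematicalPhysics.QuantumFieldTheory.QCDTransferMatrix

/-!
# Skeleton — crux `stmt-QuantumFields-17498` `ChiralGluonicCompletion`, line `Sketch_ideator5_r2`
# (card anomaly-refutes-every-branch), C1 node reshaped along card norm-gap-cold-pressure (`Sketch_ideator4_r2`)

Line lead prover-line-stmt-QuantumFields-17498-c7-0 (gen 1 continuation c7 = line cycle 8, 2026-08-17).  Rev 3 (§1/§4 landed p153217; TT landed p153592 — both imported; 5 stubs open).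

Composition (sorry-free outside the six `stub_*`):

* E* (the dead stub `stub_hereditaryPin` of line `Sketch`) ⇐ `stub_offsetCertificate` (ideator 5: an abstract BRANCH
  CERTIFICATE `W` — hereditary under reindexing and refuting the uniform lattice gap — plus, for every gapped `Hyp`-witness,
  an OFFSET FUNCTION `M : ℕ → ℝ` that is a locator for `W` (`IsOffsetFunction`), uniformly gapped on massive cutoffs
  (`MassiveGapped`) and eventually above every negative level (`EventuallyAboveNeg`); all four predicates written out inline so
  the stub is a closed statement over tree vocabulary) + C1, via `frequently_small_of_pin` (the `∃ᶠ` pin locates),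
  `exists_branch_tendsto_zero` (selection on ONE real sequence) and `restrict_restrict` — §1, proved.
* C1 (`∀ m > 0, ∃ Δ > 0, HasLatticeMassGap (reg.scheme m 0 0) Δ` for every `Hyp`-witness) ⇐ `stub_twistedClusterBound` (TT, the
  abstract twisted-trace clustering bound over `Matrix n n ℂ` with the `ℓ²` operator norm — provable now) +
  `stub_uniformNormGap` (V: `a_k Δ ≤ qcdTransferGap` on all tori `S ≥ L_k`, eventually) + `stub_coldPressure` (P₂: bounded thermal
  entropy sum at aspect ratio 2) + `stub_latticeGap_of_normGap_coldPressure` (ideator 4's `C1OfNormGapColdPressure` restricted to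
  `Hyp`-witnesses: the representation identity `qcdTorusExpect = Tr[Γ𝕋^N ·]/Tr[Γ𝕋^N]` + slice-operator bookkeeping + TT) — §2.
* C2' = `stub_continuum` verbatim from `Lines/Sketch.lean` rev 5 (global, gap-conditioned).
* crux (both route copies, by name) from the landed `chiralGluonicCompletion_of_hereditaryPin_globalContinuum` (p139623) — §3.

§4 (sorry-free, calibration): `stub_offsetCertificate ∧ C1 ⇒ E*` is the theorem `hereditaryPin_of_offsetCertificate`; so the
new chirality stub is at least as strong as the dead one at the level of `Hyp`'s SHAPE (p142184 / p144745 / p146141 apply to it a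
fortiori) — its merit is the NAMED supplier (Ward-triple data of route AnomalyRigidity, items 17716/17718), not derivability.
-/

noncomputable section

open MeasureTheory Filter Topology Matrix
open scoped Matrix.Norms.L2Operator ComplexOrder
open Literature.MathematicalPhysics.QuantumFieldTheory Literature.MathematicalPhysics.QuantumLattice
  Literature.Probability.LatticeModels
open Summit.QuantumFields.QCD.Theorems.StronglyChiralSubsequence

namespace Summit.QuantumFields.QCD.Theorems.AnomalyBranch

variable {Nf : ℕ}

/-! ## §0 The six registered stubs (each `sorry` is the whole stub; signatures are closed statements over tree vocabulary) -/

/-- **Stub (ideator 5, the line's bet) — branch certificate + offset locator.**  For `N_f ∈ {2,3}` there is a predicate `W`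
on regularisations which (h) passes to every reindexing along a strictly increasing map and (r) refutes the uniform lattice gap
at every rate (`W r → r.IsChiralAtZero`), such that every `Hyp`-witness with a lattice gap at every positive tuple admits an
offset function `M` with: (locator) along every branch on which `M → 0` some further branch carries `W`; (massive cutoffs are
uniformly gapped) for every `μ > 0` ONE rate `Δ(μ) > 0` valid at every positive tuple, eventually on the cutoffs with
`M k ≥ μ`, on all tori `S ≥ L_k`; (no eventually-negative offsets) `∀ μ > 0, ∀ᶠ k, −μ < M k`.  Instance in view: `W` = centred
Ward-triple data of route AnomalyRigidity (refuting power: item 17718 + landed 17719/16262), `M` = the PCAC offset. -/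
theorem stub_offsetCertificate : ∀ Nf : ℕ, Nf = 2 ∨ Nf = 3 → ∃ W : QCDRegularisation Nf → Prop,
    (∀ (r : QCDRegularisation Nf) (ψ : ℕ → ℕ) (hψ : StrictMono ψ), W r → W (r.restrict ψ hψ.tendsto_atTop)) ∧
    (∀ r : QCDRegularisation Nf, W r → r.IsChiralAtZero) ∧
    ∀ reg : QCDRegularisation Nf, Hyp Nf reg →
      (∀ m : Fin Nf → ℝ, (∀ f, 0 < m f) → ∃ Δ > 0, (reg.scheme m 0 0).HasLatticeMassGap Δ) →
      ∃ M : ℕ → ℝ,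
        (∀ (φ : ℕ → ℕ) (hφ : StrictMono φ), Tendsto (M ∘ φ) atTop (𝓝 0) →
          ∃ ψ : ℕ → ℕ, ∃ hψ : StrictMono ψ, W ((reg.restrict φ hφ.tendsto_atTop).restrict ψ hψ.tendsto_atTop)) ∧
        (∀ μ > (0 : ℝ), ∃ Δ > (0 : ℝ), ∀ m : Fin Nf → ℝ, (∀ f, 0 < m f) →
          ∀ (R R' : ℕ) (A : QCDLatticeObservable Nf R) (B : QCDLatticeObservable Nf R'), ∃ C : ℝ,
            ∀ᶠ k in atTop, μ ≤ M k → ∀ S : ℕ, reg.L k ≤ S → ∀ n : ℕ, n ≤ S →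
              ‖qcdLatticeConnectedCorr (reg.β k) (2 * S + 1) (fun fl => (reg.scheme m 0 0).mq fl k) A B n‖ ≤
                C * Real.exp (-(Δ * (reg.a k * n)))) ∧
        (∀ μ > (0 : ℝ), ∀ᶠ k in atTop, -μ < M k) := by
  sorry

/- **Stub (ideator 4, TT) — twisted-trace clustering bound: LANDED** (wave 1, p153592,
`Theorems/WilsonMobilityGapChiralGluonicCompletionStubTwistedClusterBound.lean`, commit 0bb802d02246), imported above under the
same fully-qualified name `Summit.QuantumFields.QCD.Theorems.AnomalyBranch.stub_twistedClusterBound`; no `sorry` here any more.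
(Proof: trace Hölder `Literature.MathematicalPhysics.QuantumLattice.norm_trace_mul_le_opNorm_mul_re_trace` + `‖Γ‖ ≤ 1` for a
Hermitian involution + cyclicity; the hypothesis `Commute Γ R` turned out to be unused.) -/

/-- **Stub (ideator 4, V) — uniform norm gap** of Lüscher's positive transfer operator along the bare trajectory of every
`Hyp`-witness: at every positive tuple `m` one rate `Δ(m) > 0` with `a_k Δ ≤ qcdTransferGap` on ALL spatial tori of side
`2S+1 ≥ 2L_k+1`, eventually in `k` (positive-metric statement: min–max levels, no determinant sign; clause (i) of `Hyp` is
exactly Lüscher's range `κ_f < 1/6`).  The Yang–Mills-hard core of the C1 node (isosinglet sector). -/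
theorem stub_uniformNormGap : ∀ Nf : ℕ, Nf = 2 ∨ Nf = 3 → ∀ reg : QCDRegularisation Nf, Hyp Nf reg →
    ∀ m : Fin Nf → ℝ, (∀ f, 0 < m f) →
      ∃ Δ : ℝ, 0 < Δ ∧ ∀ᶠ k in atTop, ∀ S : ℕ, reg.L k ≤ S →
        reg.a k * Δ ≤ @qcdTransferGap Nf (reg.β k) (2 * S + 1) ⟨Nat.succ_ne_zero _⟩
          (fun f => reg.mcrit k + reg.a k * m f / reg.Zm k) := by
  sorry

/-- **Stub (ideator 4, P₂) — cold pressure at aspect ratio 2**: the thermal entropy sum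
`θ = Σ_{j ≥ 1} (λ_j/λ₀)^{S+1}` of the transfer operator on the three-torus of side `2S+1` is summable and bounded by one
constant, for all `S ≥ L_k`, eventually in `k`, at every positive tuple along every `Hyp`-witness (`Summable` demanded
explicitly: Mathlib's `tsum` of a non-summable family is `0`). -/
theorem stub_coldPressure : ∀ Nf : ℕ, Nf = 2 ∨ Nf = 3 → ∀ reg : QCDRegularisation Nf, Hyp Nf reg →
    ∀ m : Fin Nf → ℝ, (∀ f, 0 < m f) →
      ∃ C : ℝ, ∀ᶠ k in atTop, ∀ S : ℕ, reg.L k ≤ S →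
        Summable (fun j : ℕ =>
            (qcdTransferLevel Nf (2 * S + 1) (reg.β k) (fun f => reg.mcrit k + reg.a k * m f / reg.Zm k) (j + 1) /
                qcdTransferLevel Nf (2 * S + 1) (reg.β k) (fun f => reg.mcrit k + reg.a k * m f / reg.Zm k) 0) ^
              (S + 1)) ∧
          ∑' j : ℕ,
              (qcdTransferLevel Nf (2 * S + 1) (reg.β k) (fun f => reg.mcrit k + reg.a k * m f / reg.Zm k) (j + 1) /
                  qcdTransferLevel Nf (2 * S + 1) (reg.β k) (fun f => reg.mcrit k + reg.a k * m f / reg.Zm k) 0) ^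
                (S + 1) ≤ C := by
  sorry

/-- **Stub (ideator 4, assembly of the C1 node) — `C1OfNormGapColdPressure` on `Hyp`-witnesses.**  Given the abstract
twisted-trace clustering bound (TT), for every `Hyp`-witness (clause (i) = Lüscher positivity is inside `Hyp`) and every
positive tuple: the uniform norm gap (V) and the cold pressure (P₂) give the SIGNED, all-observable, all-volume lattice gap of
the witness's own scheme.  Content: the representation identity `qcdTorusExpect β (2S+1) m X = Tr[(−1)^F 𝕋^{2S+1} X̂]/Tr[(−1)^F 𝕋^{2S+1}]`
for the tree's time-periodic `wilsonDirac`/`fermiIntegral` and Lüscher's `𝕋` (Smit (C.70), Montvay–Münster (4.34)), the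
identification of `qcdTransferLevel` with the eigenvalues of `𝕋` (min–max), and slice-operator norm bookkeeping for
`QCDLatticeObservable.onTorus`. -/
theorem stub_latticeGap_of_normGap_coldPressure :
    (∀ (n : Type) [Fintype n] [DecidableEq n] (Γ P R A B : Matrix n n ℂ),
      P * P = P → P.IsHermitian → P.trace = 1 → R.PosSemidef → P * R = 0 → R * P = 0 →
      Γ.IsHermitian → Γ * Γ = 1 → Γ * P = P → Commute Γ R →
      ∀ N t : ℕ, 1 ≤ t → t + 1 ≤ N →
        ‖(Γ * (P + R) ^ (N - t) * A * (P + R) ^ t * B).trace -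
            (Γ * P * A * P * B).trace - (Γ * P * A * R ^ t * B).trace‖ ≤
          ‖A‖ * ‖B‖ * (‖R‖ ^ (N - t) + ((R ^ (N - t)).trace).re * ‖R‖ ^ t) ∧
        ‖(Γ * P * A * R ^ t * B).trace‖ ≤ ‖A‖ * ‖B‖ * ‖R‖ ^ t ∧
        ‖(Γ * (P + R) ^ N).trace - 1‖ ≤ ((R ^ N).trace).re) →
    ∀ Nf : ℕ, Nf = 2 ∨ Nf = 3 → ∀ reg : QCDRegularisation Nf, Hyp Nf reg →
      ∀ m : Fin Nf → ℝ, (∀ f, 0 < m f) →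
        (∃ Δ : ℝ, 0 < Δ ∧ ∀ᶠ k in atTop, ∀ S : ℕ, reg.L k ≤ S →
          reg.a k * Δ ≤ @qcdTransferGap Nf (reg.β k) (2 * S + 1) ⟨Nat.succ_ne_zero _⟩
            (fun f => reg.mcrit k + reg.a k * m f / reg.Zm k)) →
        (∃ C : ℝ, ∀ᶠ k in atTop, ∀ S : ℕ, reg.L k ≤ S →
          Summable (fun j : ℕ =>
              (qcdTransferLevel Nf (2 * S + 1) (reg.β k) (fun f => reg.mcrit k + reg.a k * m f / reg.Zm k) (j + 1) /
                  qcdTransferLevel Nf (2 * S + 1) (reg.β k) (fun f => reg.mcrit k + reg.a k * m f / reg.Zm k) 0) ^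
                (S + 1)) ∧
            ∑' j : ℕ,
                (qcdTransferLevel Nf (2 * S + 1) (reg.β k) (fun f => reg.mcrit k + reg.a k * m f / reg.Zm k) (j + 1) /
                    qcdTransferLevel Nf (2 * S + 1) (reg.β k) (fun f => reg.mcrit k + reg.a k * m f / reg.Zm k) 0) ^
                  (S + 1) ≤ C) →
        ∃ Δ > 0, (reg.scheme m 0 0).HasLatticeMassGap Δ := by
  sorry

/-- **Stub (C2', verbatim from line `Sketch` rev 5) — global gap-conditioned continuum limit**: a `Hyp`-witness with a
lattice gap at every positive tuple has ONE subsequence along which, at every positive tuple, the continuum body of `QCDOf`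
holds (species renormalisations, OS data `IsQCDAlong`, non-trivial non-Gaussian glue, dynamical flavour-changing
pseudoscalars, `T.HasMassGap Δ`).  `DiagonalSpine.LatticeToContinuum` (8929)-type content for a GIVEN regularisation. -/
theorem stub_continuum : ∀ Nf : ℕ, Nf = 2 ∨ Nf = 3 → ∀ reg : QCDRegularisation Nf, Hyp Nf reg →
    (∀ m : Fin Nf → ℝ, (∀ f, 0 < m f) → ∃ Δ > 0, (reg.scheme m 0 0).HasLatticeMassGap Δ) →
      ∃ φ : ℕ → ℕ, ∃ hφ : StrictMono φ, ∀ m : Fin Nf → ℝ, (∀ f, 0 < m f) →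
        ContinuumBody Nf (reg.restrict φ hφ.tendsto_atTop) m := by
  sorry

/-! ## §1 Ideator 5's logic (the pin locates; selection on one real sequence): LANDED, p153217 —
`exists_branch_tendsto_zero`, `frequently_small_of_pin` in `Theorems/WilsonMobilityGapChiralGluonicCompletionOffsetCertificate.lean`
(imported). -/

/-! ## §2 Composition of the C1 node (ideator 4's split) -/

/-- **C1 for every `Hyp`-witness** from TT + V + P₂ + the assembly stub. -/
theorem latticeGap_of_stubs : ∀ Nf : ℕ, Nf = 2 ∨ Nf = 3 → ∀ reg : QCDRegularisation Nf, Hyp Nf reg →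
    ∀ m : Fin Nf → ℝ, (∀ f, 0 < m f) → ∃ Δ > 0, (reg.scheme m 0 0).HasLatticeMassGap Δ :=
  fun Nf hNf reg hH m hm =>
    stub_latticeGap_of_normGap_coldPressure stub_twistedClusterBound Nf hNf reg hH m hm
      (stub_uniformNormGap Nf hNf reg hH m hm) (stub_coldPressure Nf hNf reg hH m hm)

/-! ## §3 E* from the certificate stub, and the crux by name -/

/-- **E* (the hereditary pin) for every `Hyp`-witness** from the certificate/offset stub and C1: locate a branch with
`M → 0` (`frequently_small_of_pin`, `exists_branch_tendsto_zero`), pass to a sub-branch carrying `W`, and use that `W` is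
hereditary and refutes the uniform gap. -/
theorem hereditaryPin_of_stubs : ∀ Nf : ℕ, Nf = 2 ∨ Nf = 3 → ∀ reg : QCDRegularisation Nf, Hyp Nf reg →
    ∃ φ : ℕ → ℕ, ∃ hφ : StrictMono φ, ∀ (ψ : ℕ → ℕ) (hψ : StrictMono ψ),
      ((reg.restrict φ hφ.tendsto_atTop).restrict ψ hψ.tendsto_atTop).IsChiralAtZero := by
  intro Nf hNf reg hH
  obtain ⟨W, hWh, hWr, hoff⟩ := stub_offsetCertificate Nf hNf
  obtain ⟨M, hO, hmass, hneg⟩ := hoff reg hH (latticeGap_of_stubs Nf hNf reg hH)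
  obtain ⟨φ, hφ, hφ0⟩ := exists_branch_tendsto_zero (frequently_small_of_pin reg M hH.2.1 hmass hneg)
  obtain ⟨ψ, hψ, hW⟩ := hO φ hφ hφ0
  refine ⟨φ ∘ ψ, hφ.comp hψ, fun θ hθ => ?_⟩
  rw [← restrict_restrict reg φ hφ.tendsto_atTop ψ hψ.tendsto_atTop]
  exact hWr _ (hWh _ θ hθ hW)

/-- **The crux (PauliWegnerSea copy) from the six stubs**, through the landed composition
`chiralGluonicCompletion_of_hereditaryPin_globalContinuum` (p139623). -/
theorem ChiralGluonicCompletion_of : Summit.QuantumFields.QCD.Theses.PauliWegnerSea.ChiralGluonicCompletion :=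
  chiralGluonicCompletion_of_hereditaryPin_globalContinuum hereditaryPin_of_stubs latticeGap_of_stubs stub_continuum

/-- **The crux (WilsonMobilityGap copy, this lead's route)** — the two route copies are the same proposition
(`crux_eq_wilsonMobilityGap`, rfl). -/
theorem WilsonMobilityGap_ChiralGluonicCompletion_of :
    Summit.QuantumFields.QCD.Theses.WilsonMobilityGap.ChiralGluonicCompletion :=
  ChiralGluonicCompletion_of

/-! ## §4 Calibration: LANDED, p153217 (`Theorems/WilsonMobilityGapChiralGluonicCompletionOffsetCertificate.lean`, imported) —
`hereditaryPin_of_offsetCertificate` (certificate + offset ⇒ E* for any regularisation with the pin: the new chirality stub is at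
least as strong as the dead stub E* at the level of `Hyp`'s shape, so p142184 / p144745 / p146141 apply to it a fortiori),
`exists_certificate_located_iff` / `offsetCertificateAt_iff` (`W`-ELIMINATION: with `W` existential the stub says, reg by reg,
"every `M`-null branch has a hereditarily chiral sub-branch" for an admissible offset function `M` — an offset-localised
hereditary pin; the anomaly physics enters only once `W` is FIXED to typed Ward data), and the registered composition sub-goal
`wilsonMobilityGap_chiralGluonicCompletion_of_offsetCertificate` (stub_offsetCertificate → C1 → C2' → crux). -/

/-- The skeleton's E*-step is the landed abstract one (sanity link). -/
example (reg : QCDRegularisation Nf) (hpin : reg.IsChiralAtZero) (W : QCDRegularisation Nf → Prop)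
    (hWh : ∀ (r : QCDRegularisation Nf) (ψ : ℕ → ℕ) (hψ : StrictMono ψ), W r → W (r.restrict ψ hψ.tendsto_atTop))
    (hWr : ∀ r : QCDRegularisation Nf, W r → r.IsChiralAtZero) (M : ℕ → ℝ)
    (hO : ∀ (φ : ℕ → ℕ) (hφ : StrictMono φ), Tendsto (M ∘ φ) atTop (𝓝 0) →
      ∃ ψ : ℕ → ℕ, ∃ hψ : StrictMono ψ, W ((reg.restrict φ hφ.tendsto_atTop).restrict ψ hψ.tendsto_atTop))
    (hmass : ∀ μ > (0 : ℝ), ∃ Δ > (0 : ℝ), ∀ m : Fin Nf → ℝ, (∀ f, 0 < m f) →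
      ∀ (R R' : ℕ) (A : QCDLatticeObservable Nf R) (B : QCDLatticeObservable Nf R'), ∃ C : ℝ,
        ∀ᶠ k in atTop, μ ≤ M k → ∀ S : ℕ, reg.L k ≤ S → ∀ n : ℕ, n ≤ S →
          ‖qcdLatticeConnectedCorr (reg.β k) (2 * S + 1) (fun fl => (reg.scheme m 0 0).mq fl k) A B n‖ ≤
            C * Real.exp (-(Δ * (reg.a k * n))))
    (hneg : ∀ μ > (0 : ℝ), ∀ᶠ k in atTop, -μ < M k) :
    ∃ φ : ℕ → ℕ, ∃ hφ : StrictMono φ, ∀ (ψ : ℕ → ℕ) (hψ : StrictMono ψ),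
      ((reg.restrict φ hφ.tendsto_atTop).restrict ψ hψ.tendsto_atTop).IsChiralAtZero :=
  hereditaryPin_of_offsetCertificate reg hpin W hWh hWr M hO hmass hneg

end Summit.QuantumFields.QCD.Theorems.AnomalyBranch

end
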